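import Summits.CriticalPhenomena.PercolationContinuityZ3.Theorems.PercNearOneGluingNoHeavyLowerTailBlockQ9TwoDangerousPiece
import HarnessLib

/-!
# `NoHeavyLowerTail` (stmt-CriticalPhenomena-4575) — Kozma–Nitzan's Question 9 for a glued one-layer block with
# TWO DANGEROUS PORT PAIRS (the θ-mixture certificate)

Support file (hull-port / coupling seat `prim-hp-1` gen 8; `--supports stmt-CriticalPhenomena-4575`).
No definitions, no named facts, no sorries.  Memo `run/shared/lean/prim/prim-hp-1/HULLPORT-COUPLING.md` §50(d).

Setting (`Fin n`, weights `w` = the UNGLUED ranking graph, e.g. the split graph of a depth-two observer):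
a block `O` (glued: `glue_O w := fun e => if (∀ x ∈ e, x ∈ O) ∧ ¬ e.IsDiag then 1 else w e`), relays `A` disjoint
from `O`, one-layer (`w s(x,y) = 0` for `x ∈ O`, `y ∉ O ∪ A`), target `b ∉ O`, anchor relay `a ∉ O`,
`kill_O w := fun e => if (∃ x ∈ e, x ∈ O) then 0 else w e` (the block deleted).  Question 9 for the block is
`BQ : μ_{glue_O w}(a ↔ b, O ↔ A) ≤ μ_{glue_O w}(O ↔ b)`.

* `BlockQ9.blockQ9_twoDangerous` — **two dangerous pairs, no nesting**: all port pairs except `e₁ = s(p₁,s₁)` and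
  `e₂ = s(p₂,s₂)` (`s_i ∈ O`, `p_i ∉ O`, `0 < w e_i`) have ports dominating `a` in `kill_O w`, and
  `μ_w(a ↔ b) ≤ μ_w(p_i ↔ b)` for `i = 1, 2` (domination in the unglued graph only).  Then `BQ`.

Proof (the θ-mixture certificate of the memo).  Condition on the states of `e₁, e₂` (four pinned weight vectors
`g_{st}`).  The cell "both closed" is Theorem 4 for `w` with `e₁, e₂` deleted.  For `θ ∈ [0,1]` the law of the
other pairs on `{e₁ ∨ e₂ open}` is the mixture, with nonnegative coefficients, of the two ANCHORED product laws
`w⁽¹⁾_θ = w[e₁ ↦ 1, e₂ ↦ r₂(θ)]` and `w⁽²⁾_θ = w[e₂ ↦ 1, e₁ ↦ r₁(θ)]` (`odds r₂ = θ·odds(w e₂)`,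
`odds r₁ = (1−θ)·odds(w e₁)`); the up-set exchange with arbitrary internal weights
(`UpsetExchange.upsetExchange_any_block`, applied to `w⁽ⁱ⁾_θ`, anchor `p_i`, `C = {e_i}`) bounds each anchored piece by
the block as soon as `μ_{w⁽ⁱ⁾_θ}(a ↔ b) ≤ μ_{w⁽ⁱ⁾_θ}(p_i ↔ b)` (`piece`).  A `θ` satisfying BOTH anchor conditions
exists: writing `α_i` for the advantage of `a` over `p_i` on the cell "only `e_i` open" and `β_i` for the advantage of
`p_i` over `a` on the cell "both open", the conditions read `θ β₁ ≥ α₁`, `(1−θ) β₂ ≥ α₂`; Lemma 3(i)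
(`SeqExchange.lemma3i_pair`) gives `α_i ≤ β_i` and the two-edge sequential Lemma 3(i) (`SeqExchange.seq_two`, both
orders) gives `α₁ + α₂ ≤ β₁` and `α₁ + α₂ ≤ β₂`, whence `θ = α₁⁺/(α₁⁺ + α₂⁺)` works.
[cite: KozmaNitzan2024, Lemma 3(i), Lemma 5, Thm. 4, Question 9 (pp. 6, 13–14, 36)]
-/

namespace Summit.CriticalPhenomena.PercolationContinuityZ3.Theorems

open MeasureTheory Set
open Literature.Probability.LatticeModels
open Literature.Probability.Percolation

noncomputable section
open Classical

namespace BlockQ9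

variable {n : ℕ}

/-- **Question 9 for a glued one-layer block with two dangerous port pairs.**  `O` disjoint from `A`, one-layer;
`a, b ∉ O`; two boundary pairs `e_i = s(p_i, s_i)` (`s_i ∈ O`, `p_i ∉ O`, positive weight, `e₁ ≠ e₂`); every OTHER
positive pair from `O` to a relay `v` has `v` dominating `a` in the block-deleted graph `kill_O w`; and
`μ_w(a ↔ b) ≤ μ_w(p_i ↔ b)` (`i = 1,2`) in the UNGLUED graph `w`.  Then
`μ_{glue_O w}(a ↔ b, O ↔ A) ≤ μ_{glue_O w}(O ↔ b)`.  (The internal weights of `O` in `w` are arbitrary.)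
[cite: KozmaNitzan2024, Thm. 4, Lemma 5, Lemma 3(i), Question 9 (pp. 6, 12–14, 36); this work (memo §50(d))] -/
theorem blockQ9_twoDangerous (w : Sym2 (Fin n) → unitInterval) (O A : Finset (Fin n))
    (a b p₁ s₁ p₂ s₂ : Fin n)
    (hOA : Disjoint O A) (haO : a ∉ O) (hbO : b ∉ O) (hp₁O : p₁ ∉ O) (hp₂O : p₂ ∉ O)
    (hs₁ : s₁ ∈ O) (hs₂ : s₂ ∈ O) (hne : s(p₁, s₁) ≠ s(p₂, s₂))
    (hpos₁ : w s(p₁, s₁) ≠ 0) (hpos₂ : w s(p₂, s₂) ≠ 0)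
    (hiso : ∀ x ∈ O, ∀ y : Fin n, y ∉ O → y ∉ A → w s(x, y) = 0)
    (hdom : ∀ v ∈ A, ∀ o ∈ O, w s(o, v) ≠ 0 → s(o, v) ≠ s(p₁, s₁) → s(o, v) ≠ s(p₂, s₂) →
      (prodBernoulli (fun e : Sym2 (Fin n) => if (∃ x ∈ e, x ∈ O) then 0 else w e)).real (openConn a b) ≤
        (prodBernoulli (fun e : Sym2 (Fin n) => if (∃ x ∈ e, x ∈ O) then 0 else w e)).real (openConn v b))
    (hyp₁ : (prodBernoulli w).real (openConn a b) ≤ (prodBernoulli w).real (openConn p₁ b))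
    (hyp₂ : (prodBernoulli w).real (openConn a b) ≤ (prodBernoulli w).real (openConn p₂ b)) :
    (prodBernoulli (fun e : Sym2 (Fin n) => if (∀ x ∈ e, x ∈ O) ∧ ¬ e.IsDiag then 1 else w e)).real
        (openConn a b ∩ ⋃ o ∈ O, ⋃ x ∈ A, openConn o x) ≤
      (prodBernoulli (fun e : Sym2 (Fin n) => if (∀ x ∈ e, x ∈ O) ∧ ¬ e.IsDiag then 1 else w e)).real
        (⋃ o ∈ O, openConn o b) := by
  have hps₁ : p₁ ≠ s₁ := fun h => hp₁O (h ▸ hs₁)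
  have hps₂ : p₂ ≠ s₂ := fun h => hp₂O (h ▸ hs₂)
  have hne' : s(p₂, s₂) ≠ s(p₁, s₁) := fun h => hne h.symm
  have he₁_nint : ¬ ((∀ x ∈ s(p₁, s₁), x ∈ O) ∧ ¬ (s(p₁, s₁)).IsDiag) :=
    fun h => hp₁O (h.1 p₁ (Sym2.mem_mk_left p₁ s₁))
  have he₂_nint : ¬ ((∀ x ∈ s(p₂, s₂), x ∈ O) ∧ ¬ (s(p₂, s₂)).IsDiag) :=
    fun h => hp₂O (h.1 p₂ (Sym2.mem_mk_left p₂ s₂))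
  have he₁_meets : ∃ x ∈ s(p₁, s₁), x ∈ O := ⟨s₁, Sym2.mem_mk_right p₁ s₁, hs₁⟩
  have he₂_meets : ∃ x ∈ s(p₂, s₂), x ∈ O := ⟨s₂, Sym2.mem_mk_right p₂ s₂, hs₂⟩
  obtain ⟨e₁, he₁⟩ : ∃ e : Sym2 (Fin n), e = s(p₁, s₁) := ⟨_, rfl⟩
  obtain ⟨e₂, he₂⟩ : ∃ e : Sym2 (Fin n), e = s(p₂, s₂) := ⟨_, rfl⟩
  obtain ⟨g, hg⟩ : ∃ g : Sym2 (Fin n) → unitInterval,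
      g = fun e : Sym2 (Fin n) => if (∀ x ∈ e, x ∈ O) ∧ ¬ e.IsDiag then (1 : unitInterval) else w e := ⟨_, rfl⟩
  rw [← hg]
  rw [← he₁] at hne hne' hpos₁ he₁_nint he₁_meets hdom
  rw [← he₂] at hne hne' hpos₂ he₂_nint he₂_meets hdom
  obtain ⟨OA, hOAdef⟩ : ∃ S : Set (BondConfig (Fin n)), S = ⋃ o ∈ O, ⋃ x ∈ A, openConn o x := ⟨_, rfl⟩
  obtain ⟨Ob, hObdef⟩ : ∃ S : Set (BondConfig (Fin n)), S = ⋃ o ∈ O, openConn o b := ⟨_, rfl⟩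
  rw [← hOAdef, ← hObdef]
  obtain ⟨ρ₁, hρ₁⟩ : ∃ t : ℝ, t = (w e₁ : ℝ) := ⟨_, rfl⟩
  obtain ⟨ρ₂, hρ₂⟩ : ∃ t : ℝ, t = (w e₂ : ℝ) := ⟨_, rfl⟩
  have hρ₁0 : 0 ≤ ρ₁ := by rw [hρ₁]; exact (w e₁).2.1
  have hρ₁1 : ρ₁ ≤ 1 := by rw [hρ₁]; exact (w e₁).2.2
  have hρ₂0 : 0 ≤ ρ₂ := by rw [hρ₂]; exact (w e₂).2.1
  have hρ₂1 : ρ₂ ≤ 1 := by rw [hρ₂]; exact (w e₂).2.2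
  have hρ₁pos : 0 < ρ₁ := by
    rw [hρ₁]; exact lt_of_le_of_ne (w e₁).2.1 (fun h => hpos₁ (Subtype.ext h.symm))
  have hρ₂pos : 0 < ρ₂ := by
    rw [hρ₂]; exact lt_of_le_of_ne (w e₂).2.1 (fun h => hpos₂ (Subtype.ext h.symm))
  have hge₁ : g e₁ = w e₁ := by rw [hg]; exact if_neg he₁_nint
  have hge₂ : g e₂ = w e₂ := by rw [hg]; exact if_neg he₂_nint
  have hW₂ : ∀ s : unitInterval, ((Function.update w e₁ s) e₂ : ℝ) = ρ₂ := fun s => by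
    rw [Function.update_of_ne hne', hρ₂]
  have hG₂ : ∀ s : unitInterval, ((Function.update g e₁ s) e₂ : ℝ) = ρ₂ := fun s => by
    rw [Function.update_of_ne hne', hge₂, hρ₂]
  -- one-bond decompositions along `e₁` then `e₂`
  have dG : ∀ Y : Set (BondConfig (Fin n)), (prodBernoulli g).real Y =
      (1 - ρ₁) * ((1 - ρ₂) * (prodBernoulli (Function.update (Function.update g e₁ 0) e₂ 0)).real Y +
        ρ₂ * (prodBernoulli (Function.update (Function.update g e₁ 0) e₂ 1)).real Y) +
      ρ₁ * ((1 - ρ₂) * (prodBernoulli (Function.update (Function.update g e₁ 1) e₂ 0)).real Y +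
        ρ₂ * (prodBernoulli (Function.update (Function.update g e₁ 1) e₂ 1)).real Y) := by
    intro Y
    rw [stub_oneBondDecomp_k15 n g e₁ Y, stub_oneBondDecomp_k15 n (Function.update g e₁ 0) e₂ Y,
      stub_oneBondDecomp_k15 n (Function.update g e₁ 1) e₂ Y, hG₂, hG₂, hge₁, ← hρ₁]
  have dW_e₁ : ∀ Y : Set (BondConfig (Fin n)), (prodBernoulli w).real (Y ∩ {ω | s(p₁, s₁) ∈ ω}) =
      ρ₁ * ((1 - ρ₂) * (prodBernoulli (Function.update (Function.update w e₁ 1) e₂ 0)).real Y +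
        ρ₂ * (prodBernoulli (Function.update (Function.update w e₁ 1) e₂ 1)).real Y) := by
    intro Y
    rw [← he₁, goodStepEI_real_inter_open_eq w e₁ Y, stub_oneBondDecomp_k15 n (Function.update w e₁ 1) e₂ Y,
      hW₂, ← hρ₁]
  have dW_e₂ : ∀ Y : Set (BondConfig (Fin n)), (prodBernoulli w).real (Y ∩ {ω | s(p₂, s₂) ∈ ω}) =
      ρ₂ * ((1 - ρ₁) * (prodBernoulli (Function.update (Function.update w e₁ 0) e₂ 1)).real Y +
        ρ₁ * (prodBernoulli (Function.update (Function.update w e₁ 1) e₂ 1)).real Y) := by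
    intro Y
    rw [← he₂, goodStepEI_real_inter_open_eq w e₂ Y, stub_oneBondDecomp_k15 n (Function.update w e₂ 1) e₁ Y,
      Function.update_of_ne hne, Function.update_comm hne', Function.update_comm hne', ← hρ₁, ← hρ₂]
  have dW_ne₁e₂ : ∀ Y : Set (BondConfig (Fin n)),
      (prodBernoulli w).real (Y ∩ {ω | s(p₁, s₁) ∉ ω} ∩ {ω | s(p₂, s₂) ∈ ω}) =
        (1 - ρ₁) * (ρ₂ * (prodBernoulli (Function.update (Function.update w e₁ 0) e₂ 1)).real Y) := by
    intro Y
    rw [← he₁, ← he₂, Set.inter_right_comm, goodStepEI_real_inter_closed_eq w e₁ _,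
      goodStepEI_real_inter_open_eq (Function.update w e₁ 0) e₂ Y, hW₂, ← hρ₁]
  have dW_ne₂e₁ : ∀ Y : Set (BondConfig (Fin n)),
      (prodBernoulli w).real (Y ∩ {ω | s(p₂, s₂) ∉ ω} ∩ {ω | s(p₁, s₁) ∈ ω}) =
        (1 - ρ₂) * (ρ₁ * (prodBernoulli (Function.update (Function.update w e₁ 1) e₂ 0)).real Y) := by
    intro Y
    rw [← he₁, ← he₂, Set.inter_right_comm, goodStepEI_real_inter_closed_eq w e₂ _,
      goodStepEI_real_inter_open_eq (Function.update w e₂ 0) e₁ Y, Function.update_of_ne hne,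
      Function.update_comm hne', ← hρ₁, ← hρ₂]
  -- unglued cell quantities
  obtain ⟨X01, hX01⟩ : ∃ t : ℝ, t = (prodBernoulli (Function.update (Function.update w e₁ 0) e₂ 1)).real
    (openConn a b) := ⟨_, rfl⟩
  obtain ⟨X10, hX10⟩ : ∃ t : ℝ, t = (prodBernoulli (Function.update (Function.update w e₁ 1) e₂ 0)).real
    (openConn a b) := ⟨_, rfl⟩
  obtain ⟨X11, hX11⟩ : ∃ t : ℝ, t = (prodBernoulli (Function.update (Function.update w e₁ 1) e₂ 1)).real
    (openConn a b) := ⟨_, rfl⟩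
  obtain ⟨P0, hP0⟩ : ∃ t : ℝ, t = (prodBernoulli (Function.update (Function.update w e₁ 1) e₂ 0)).real
    (openConn p₁ b) := ⟨_, rfl⟩
  obtain ⟨P1, hP1⟩ : ∃ t : ℝ, t = (prodBernoulli (Function.update (Function.update w e₁ 1) e₂ 1)).real
    (openConn p₁ b) := ⟨_, rfl⟩
  obtain ⟨Q0, hQ0⟩ : ∃ t : ℝ, t = (prodBernoulli (Function.update (Function.update w e₁ 0) e₂ 1)).real
    (openConn p₂ b) := ⟨_, rfl⟩
  obtain ⟨Q1, hQ1⟩ : ∃ t : ℝ, t = (prodBernoulli (Function.update (Function.update w e₁ 1) e₂ 1)).real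
    (openConn p₂ b) := ⟨_, rfl⟩
  obtain ⟨α₁, hα₁⟩ : ∃ t : ℝ, t = ρ₁ * (1 - ρ₂) * (X10 - P0) := ⟨_, rfl⟩
  obtain ⟨β₁, hβ₁⟩ : ∃ t : ℝ, t = ρ₁ * ρ₂ * (P1 - X11) := ⟨_, rfl⟩
  obtain ⟨α₂, hα₂⟩ : ∃ t : ℝ, t = (1 - ρ₁) * ρ₂ * (X01 - Q0) := ⟨_, rfl⟩
  obtain ⟨β₂, hβ₂⟩ : ∃ t : ℝ, t = ρ₁ * ρ₂ * (Q1 - X11) := ⟨_, rfl⟩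
  -- Lemma 3(i) for each pair, and the sequential lemma in both orders
  have hyp₁' : (prodBernoulli w).real (openConn a b) ≤ (prodBernoulli w).real (openConn p₁ b) + 0 := by
    rw [add_zero]; exact hyp₁
  have hyp₂' : (prodBernoulli w).real (openConn a b) ≤ (prodBernoulli w).real (openConn p₂ b) + 0 := by
    rw [add_zero]; exact hyp₂
  have L1 : α₁ ≤ β₁ := by
    have h := SeqExchange.lemma3i_pair w a p₁ s₁ b hps₁ le_rfl hyp₁'
    rw [zero_mul, add_zero, dW_e₁, dW_e₁] at h
    rw [← hX10, ← hX11, ← hP0, ← hP1] at h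
    have : β₁ - α₁ = ρ₁ * ((1 - ρ₂) * P0 + ρ₂ * P1) - ρ₁ * ((1 - ρ₂) * X10 + ρ₂ * X11) := by
      rw [hα₁, hβ₁]; ring
    linarith
  have L2 : α₂ ≤ β₂ := by
    have h := SeqExchange.lemma3i_pair w a p₂ s₂ b hps₂ le_rfl hyp₂'
    rw [zero_mul, add_zero, dW_e₂, dW_e₂] at h
    rw [← hX01, ← hX11, ← hQ0, ← hQ1] at h
    have : β₂ - α₂ = ρ₂ * ((1 - ρ₁) * Q0 + ρ₁ * Q1) - ρ₂ * ((1 - ρ₁) * X01 + ρ₁ * X11) := by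
      rw [hα₂, hβ₂]; ring
    linarith
  have S12 : α₁ + α₂ ≤ β₁ := by
    have h := SeqExchange.seq_two w a p₁ s₁ p₂ s₂ b hps₁ hps₂ le_rfl hyp₁' hyp₂'
    rw [max_self, add_zero, dW_e₁, dW_e₁, dW_ne₁e₂, dW_ne₁e₂] at h
    rw [← hX01, ← hX10, ← hX11, ← hP0, ← hP1, ← hQ0] at h
    have : β₁ - α₁ - α₂ = ρ₁ * ((1 - ρ₂) * P0 + ρ₂ * P1) + (1 - ρ₁) * (ρ₂ * Q0) -
        (ρ₁ * ((1 - ρ₂) * X10 + ρ₂ * X11) + (1 - ρ₁) * (ρ₂ * X01)) := by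
      rw [hα₁, hβ₁, hα₂]; ring
    linarith
  have S21 : α₁ + α₂ ≤ β₂ := by
    have h := SeqExchange.seq_two w a p₂ s₂ p₁ s₁ b hps₂ hps₁ le_rfl hyp₂' hyp₁'
    rw [max_self, add_zero, dW_e₂, dW_e₂, dW_ne₂e₁, dW_ne₂e₁] at h
    rw [← hX01, ← hX10, ← hX11, ← hP0, ← hQ0, ← hQ1] at h
    have : β₂ - α₁ - α₂ = ρ₂ * ((1 - ρ₁) * Q0 + ρ₁ * Q1) + (1 - ρ₂) * (ρ₁ * P0) -
        (ρ₂ * ((1 - ρ₁) * X01 + ρ₁ * X11) + (1 - ρ₂) * (ρ₁ * X10)) := by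
      rw [hα₁, hβ₂, hα₂]; ring
    linarith
  -- the mixture parameter
  obtain ⟨θ, hθ0, hθ1, hA1, hA2⟩ := exists_theta L1 L2 S12 S21
  -- glued cell quantities
  obtain ⟨TA00, hTA00⟩ : ∃ t : ℝ, t = (prodBernoulli (Function.update (Function.update g e₁ 0) e₂ 0)).real
    (openConn a b ∩ OA) := ⟨_, rfl⟩
  obtain ⟨TA01, hTA01⟩ : ∃ t : ℝ, t = (prodBernoulli (Function.update (Function.update g e₁ 0) e₂ 1)).real
    (openConn a b ∩ OA) := ⟨_, rfl⟩
  obtain ⟨TA10, hTA10⟩ : ∃ t : ℝ, t = (prodBernoulli (Function.update (Function.update g e₁ 1) e₂ 0)).real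
    (openConn a b ∩ OA) := ⟨_, rfl⟩
  obtain ⟨TA11, hTA11⟩ : ∃ t : ℝ, t = (prodBernoulli (Function.update (Function.update g e₁ 1) e₂ 1)).real
    (openConn a b ∩ OA) := ⟨_, rfl⟩
  obtain ⟨TB01, hTB01⟩ : ∃ t : ℝ, t = (prodBernoulli (Function.update (Function.update g e₁ 0) e₂ 1)).real
    (openConn a b) := ⟨_, rfl⟩
  obtain ⟨TB10, hTB10⟩ : ∃ t : ℝ, t = (prodBernoulli (Function.update (Function.update g e₁ 1) e₂ 0)).real
    (openConn a b) := ⟨_, rfl⟩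
  obtain ⟨TB11, hTB11⟩ : ∃ t : ℝ, t = (prodBernoulli (Function.update (Function.update g e₁ 1) e₂ 1)).real
    (openConn a b) := ⟨_, rfl⟩
  obtain ⟨TO00, hTO00⟩ : ∃ t : ℝ, t = (prodBernoulli (Function.update (Function.update g e₁ 0) e₂ 0)).real
    Ob := ⟨_, rfl⟩
  obtain ⟨TO01, hTO01⟩ : ∃ t : ℝ, t = (prodBernoulli (Function.update (Function.update g e₁ 0) e₂ 1)).real
    Ob := ⟨_, rfl⟩
  obtain ⟨TO10, hTO10⟩ : ∃ t : ℝ, t = (prodBernoulli (Function.update (Function.update g e₁ 1) e₂ 0)).real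
    Ob := ⟨_, rfl⟩
  obtain ⟨TO11, hTO11⟩ : ∃ t : ℝ, t = (prodBernoulli (Function.update (Function.update g e₁ 1) e₂ 1)).real
    Ob := ⟨_, rfl⟩
  have hAB01 : TA01 ≤ TB01 := by
    rw [hTA01, hTB01]; exact measureReal_mono Set.inter_subset_left (measure_ne_top _ _)
  have hAB10 : TA10 ≤ TB10 := by
    rw [hTA10, hTB10]; exact measureReal_mono Set.inter_subset_left (measure_ne_top _ _)
  have hAB11 : TA11 ≤ TB11 := by
    rw [hTA11, hTB11]; exact measureReal_mono Set.inter_subset_left (measure_ne_top _ _)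
  -- cell `00`: Theorem 4 for `w` with both pairs deleted
  have h00 : TA00 ≤ TO00 := by
    have hglue : (fun f : Sym2 (Fin n) => if (∀ x ∈ f, x ∈ O) ∧ ¬ f.IsDiag then (1 : unitInterval) else
        Function.update (Function.update w e₁ 0) e₂ 0 f) = Function.update (Function.update g e₁ 0) e₂ 0 := by
      rw [glue_update_of_not_internal _ O e₂ he₂_nint, glue_update_of_not_internal _ O e₁ he₁_nint, hg]
    have hkill : (fun f : Sym2 (Fin n) => if (∃ x ∈ f, x ∈ O) then (0 : unitInterval) else
        Function.update (Function.update w e₁ 0) e₂ 0 f) =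
        fun f : Sym2 (Fin n) => if (∃ x ∈ f, x ∈ O) then (0 : unitInterval) else w f := by
      rw [kill_update_of_meets _ O e₂ he₂_meets, kill_update_of_meets _ O e₁ he₁_meets]
    have hW00 : ∀ f : Sym2 (Fin n), Function.update (Function.update w e₁ 0) e₂ 0 f = 0 ∨
        Function.update (Function.update w e₁ 0) e₂ 0 f = w f := by
      intro f
      by_cases h2 : f = e₂
      · subst h2; left; rw [Function.update_self]
      · rw [Function.update_of_ne h2]
        by_cases h1 : f = e₁
        · subst h1; left; rw [Function.update_self]
        · right; rw [Function.update_of_ne h1]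
    have hiso' : ∀ x ∈ O, ∀ y : Fin n, y ∉ O → y ∉ A →
        Function.update (Function.update w e₁ 0) e₂ 0 s(x, y) = 0 := by
      intro x hx y hyO hyA
      rcases hW00 s(x, y) with h | h
      · exact h
      · rw [h]; exact hiso x hx y hyO hyA
    have hdom' : ∀ v ∈ A, (∃ o ∈ O, Function.update (Function.update w e₁ 0) e₂ 0 s(o, v) ≠ 0) →
        (prodBernoulli (fun f : Sym2 (Fin n) => if (∃ x ∈ f, x ∈ O) then 0 else
          Function.update (Function.update w e₁ 0) e₂ 0 f)).real (openConn a b) ≤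
          (prodBernoulli (fun f : Sym2 (Fin n) => if (∃ x ∈ f, x ∈ O) then 0 else
            Function.update (Function.update w e₁ 0) e₂ 0 f)).real (openConn v b) := by
      intro v hvA ⟨o, hoO, hov⟩
      rw [hkill]
      have hne₁ : s(o, v) ≠ e₁ := by
        intro h
        apply hov
        rw [h, Function.update_of_ne hne, Function.update_self]
      have hne₂ : s(o, v) ≠ e₂ := by
        intro h
        apply hov
        rw [h, Function.update_self]
      have hw : w s(o, v) ≠ 0 := by
        intro h
        apply hov
        rw [Function.update_of_ne hne₂, Function.update_of_ne hne₁, h]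
      exact hdom v hvA o hoO hw hne₁ hne₂
    have key := blockThm4_witness (Function.update (Function.update w e₁ 0) e₂ 0) O A a b hOA haO hbO
      hiso' hdom'
    rw [hglue, ← hOAdef, ← hObdef, ← hTA00, ← hTO00] at key
    exact key
  -- the two anchored pieces
  obtain ⟨κ₁, hκ₁⟩ : ∃ t : ℝ, t = ρ₁ * (1 - ρ₂) := ⟨_, rfl⟩
  obtain ⟨κ₂, hκ₂⟩ : ∃ t : ℝ, t = (1 - ρ₁) * ρ₂ := ⟨_, rfl⟩
  obtain ⟨lam₁, hlam₁⟩ : ∃ t : ℝ, t = θ * (ρ₁ * ρ₂) := ⟨_, rfl⟩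
  obtain ⟨lam₂, hlam₂⟩ : ∃ t : ℝ, t = (1 - θ) * (ρ₁ * ρ₂) := ⟨_, rfl⟩
  have hκ₁0 : 0 ≤ κ₁ := by rw [hκ₁]; exact mul_nonneg hρ₁0 (by linarith)
  have hκ₂0 : 0 ≤ κ₂ := by rw [hκ₂]; exact mul_nonneg (by linarith) hρ₂0
  have hlam₁0 : 0 ≤ lam₁ := by rw [hlam₁]; exact mul_nonneg hθ0 (mul_nonneg hρ₁0 hρ₂0)
  have hlam₂0 : 0 ≤ lam₂ := by rw [hlam₂]; exact mul_nonneg (by linarith) (mul_nonneg hρ₁0 hρ₂0)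
  have hak₁ : α₁ = κ₁ * (X10 - P0) := by rw [hα₁, hκ₁]
  have hbl₁ : θ * β₁ = lam₁ * (P1 - X11) := by rw [hβ₁, hlam₁]; ring
  have hak₂ : α₂ = κ₂ * (X01 - Q0) := by rw [hα₂, hκ₂]
  have hbl₂ : (1 - θ) * β₂ = lam₂ * (Q1 - X11) := by rw [hβ₂, hlam₂]; ring
  -- piece 1 (anchor `p₁`, pair `e₁` forced open, `e₂` re-weighted)
  have piece₁ : κ₁ * (TB10 - TO10) + lam₁ * (TB11 - TO11) ≤ 0 := by
    by_cases hm : κ₁ + lam₁ = 0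
    · have h1 : κ₁ = 0 := le_antisymm (by linarith) hκ₁0
      have h2 : lam₁ = 0 := le_antisymm (by linarith) hlam₁0
      rw [h1, h2]; simp
    have hmpos : 0 < κ₁ + lam₁ := lt_of_le_of_ne (by linarith) (Ne.symm hm)
    obtain ⟨r, hr⟩ : ∃ t : ℝ, t = lam₁ / (κ₁ + lam₁) := ⟨_, rfl⟩
    have hr0 : 0 ≤ r := by rw [hr]; exact div_nonneg hlam₁0 hmpos.le
    have hr1 : r ≤ 1 := by rw [hr]; exact (div_le_one hmpos).2 (by linarith)
    have h1r : 1 - r = κ₁ / (κ₁ + lam₁) := by rw [hr]; field_simp; ring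
    have hrm : r * (κ₁ + lam₁) = lam₁ := by rw [hr]; field_simp
    have h1rm : (1 - r) * (κ₁ + lam₁) = κ₁ := by rw [h1r]; field_simp
    let ru : unitInterval := ⟨r, hr0, hr1⟩
    have hcoe : ((ru : unitInterval) : ℝ) = r := rfl
    -- the anchor condition
    have hanchor : (prodBernoulli (Function.update (Function.update w s(p₁, s₁) 1) e₂ ru)).real (openConn a b) ≤
        (prodBernoulli (Function.update (Function.update w s(p₁, s₁) 1) e₂ ru)).real (openConn p₁ b) := by
      rw [← he₁]
      have da := stub_oneBondDecomp_k15 n (Function.update (Function.update w e₁ 1) e₂ ru) e₂ (openConn a b)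
      have dp := stub_oneBondDecomp_k15 n (Function.update (Function.update w e₁ 1) e₂ ru) e₂ (openConn p₁ b)
      rw [Function.update_self, Function.update_idem, Function.update_idem, hcoe] at da dp
      rw [← hX10, ← hX11] at da
      rw [← hP0, ← hP1] at dp
      rw [da, dp]
      have key : (κ₁ + lam₁) * (((1 - r) * X10 + r * X11) - ((1 - r) * P0 + r * P1)) = α₁ - θ * β₁ := by
        have : (κ₁ + lam₁) * (((1 - r) * X10 + r * X11) - ((1 - r) * P0 + r * P1)) =
            ((1 - r) * (κ₁ + lam₁)) * (X10 - P0) - (r * (κ₁ + lam₁)) * (P1 - X11) := by ring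
        rw [this, hrm, h1rm, hak₁, hbl₁]
      have hneg : (κ₁ + lam₁) * (((1 - r) * X10 + r * X11) - ((1 - r) * P0 + r * P1)) ≤ 0 := by
        rw [key]; linarith
      by_contra hcon
      push Not at hcon
      have : 0 < (κ₁ + lam₁) * (((1 - r) * X10 + r * X11) - ((1 - r) * P0 + r * P1)) :=
        mul_pos hmpos (by linarith)
      linarith
    have key := piece w O a b p₁ s₁ e₂ ru hp₁O hs₁ he₂_nint (by rw [← he₁]; exact hne') hanchor
    rw [← he₁, ← hg, hcoe, ← hObdef, ← hTB10, ← hTB11, ← hTO10, ← hTO11] at key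
    -- multiply by `κ₁ + lam₁`
    have hmul := mul_nonpos_of_nonneg_of_nonpos hmpos.le key
    have hid : (κ₁ + lam₁) * ((1 - r) * (TB10 - TO10) + r * (TB11 - TO11)) =
        ((1 - r) * (κ₁ + lam₁)) * (TB10 - TO10) + (r * (κ₁ + lam₁)) * (TB11 - TO11) := by ring
    rw [hid, hrm, h1rm] at hmul
    exact hmul
  -- piece 2 (anchor `p₂`, pair `e₂` forced open, `e₁` re-weighted)
  have piece₂ : κ₂ * (TB01 - TO01) + lam₂ * (TB11 - TO11) ≤ 0 := by
    by_cases hm : κ₂ + lam₂ = 0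
    · have h1 : κ₂ = 0 := le_antisymm (by linarith) hκ₂0
      have h2 : lam₂ = 0 := le_antisymm (by linarith) hlam₂0
      rw [h1, h2]; simp
    have hmpos : 0 < κ₂ + lam₂ := lt_of_le_of_ne (by linarith) (Ne.symm hm)
    obtain ⟨r, hr⟩ : ∃ t : ℝ, t = lam₂ / (κ₂ + lam₂) := ⟨_, rfl⟩
    have hr0 : 0 ≤ r := by rw [hr]; exact div_nonneg hlam₂0 hmpos.le
    have hr1 : r ≤ 1 := by rw [hr]; exact (div_le_one hmpos).2 (by linarith)
    have h1r : 1 - r = κ₂ / (κ₂ + lam₂) := by rw [hr]; field_simp; ring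
    have hrm : r * (κ₂ + lam₂) = lam₂ := by rw [hr]; field_simp
    have h1rm : (1 - r) * (κ₂ + lam₂) = κ₂ := by rw [h1r]; field_simp
    let ru : unitInterval := ⟨r, hr0, hr1⟩
    have hcoe : ((ru : unitInterval) : ℝ) = r := rfl
    have hW' : ∀ t : unitInterval, Function.update (Function.update w e₂ 1) e₁ t =
        Function.update (Function.update w e₁ t) e₂ 1 := fun t => (Function.update_comm hne t 1 w).symm
    have hG' : ∀ t : unitInterval, Function.update (Function.update g e₂ 1) e₁ t =
        Function.update (Function.update g e₁ t) e₂ 1 := fun t => (Function.update_comm hne t 1 g).symm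
    have hanchor : (prodBernoulli (Function.update (Function.update w s(p₂, s₂) 1) e₁ ru)).real (openConn a b) ≤
        (prodBernoulli (Function.update (Function.update w s(p₂, s₂) 1) e₁ ru)).real (openConn p₂ b) := by
      rw [← he₂]
      have da := stub_oneBondDecomp_k15 n (Function.update (Function.update w e₂ 1) e₁ ru) e₁ (openConn a b)
      have dp := stub_oneBondDecomp_k15 n (Function.update (Function.update w e₂ 1) e₁ ru) e₁ (openConn p₂ b)
      rw [Function.update_self, Function.update_idem, Function.update_idem, hcoe, hW' 0, hW' 1] at da dp
      rw [← hX01, ← hX11] at da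
      rw [← hQ0, ← hQ1] at dp
      rw [da, dp]
      have key : (κ₂ + lam₂) * (((1 - r) * X01 + r * X11) - ((1 - r) * Q0 + r * Q1)) = α₂ - (1 - θ) * β₂ := by
        have : (κ₂ + lam₂) * (((1 - r) * X01 + r * X11) - ((1 - r) * Q0 + r * Q1)) =
            ((1 - r) * (κ₂ + lam₂)) * (X01 - Q0) - (r * (κ₂ + lam₂)) * (Q1 - X11) := by ring
        rw [this, hrm, h1rm, hak₂, hbl₂]
      have hneg : (κ₂ + lam₂) * (((1 - r) * X01 + r * X11) - ((1 - r) * Q0 + r * Q1)) ≤ 0 := by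
        rw [key]; linarith
      by_contra hcon
      push Not at hcon
      have : 0 < (κ₂ + lam₂) * (((1 - r) * X01 + r * X11) - ((1 - r) * Q0 + r * Q1)) :=
        mul_pos hmpos (by linarith)
      linarith
    have key := piece w O a b p₂ s₂ e₁ ru hp₂O hs₂ he₁_nint (by rw [← he₂]; exact hne) hanchor
    rw [← he₂, ← hg, hcoe, hG' 0, hG' 1, ← hObdef, ← hTB01, ← hTB11, ← hTO01, ← hTO11] at key
    have hmul := mul_nonpos_of_nonneg_of_nonpos hmpos.le key
    have hid : (κ₂ + lam₂) * ((1 - r) * (TB01 - TO01) + r * (TB11 - TO11)) =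
        ((1 - r) * (κ₂ + lam₂)) * (TB01 - TO01) + (r * (κ₂ + lam₂)) * (TB11 - TO11) := by ring
    rw [hid, hrm, h1rm] at hmul
    exact hmul
  -- assemble the four cells
  rw [dG (openConn a b ∩ OA), dG Ob, ← hTA00, ← hTA01, ← hTA10, ← hTA11, ← hTO00, ← hTO01, ← hTO10, ← hTO11]
  have hsum : lam₁ + lam₂ = ρ₁ * ρ₂ := by rw [hlam₁, hlam₂]; ring
  have c00 : 0 ≤ (1 - ρ₁) * (1 - ρ₂) := mul_nonneg (by linarith) (by linarith)
  have t00 : (1 - ρ₁) * (1 - ρ₂) * (TA00 - TO00) ≤ 0 :=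
    mul_nonpos_of_nonneg_of_nonpos c00 (by linarith)
  have t01 : κ₂ * (TA01 - TO01) ≤ κ₂ * (TB01 - TO01) := mul_le_mul_of_nonneg_left (by linarith) hκ₂0
  have t10 : κ₁ * (TA10 - TO10) ≤ κ₁ * (TB10 - TO10) := mul_le_mul_of_nonneg_left (by linarith) hκ₁0
  have t11a : lam₁ * (TA11 - TO11) ≤ lam₁ * (TB11 - TO11) := mul_le_mul_of_nonneg_left (by linarith) hlam₁0
  have t11b : lam₂ * (TA11 - TO11) ≤ lam₂ * (TB11 - TO11) := mul_le_mul_of_nonneg_left (by linarith) hlam₂0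
  have hgoal : (1 - ρ₁) * ((1 - ρ₂) * TA00 + ρ₂ * TA01) + ρ₁ * ((1 - ρ₂) * TA10 + ρ₂ * TA11) -
      ((1 - ρ₁) * ((1 - ρ₂) * TO00 + ρ₂ * TO01) + ρ₁ * ((1 - ρ₂) * TO10 + ρ₂ * TO11)) =
      (1 - ρ₁) * (1 - ρ₂) * (TA00 - TO00) + κ₂ * (TA01 - TO01) + κ₁ * (TA10 - TO10) +
        (lam₁ * (TA11 - TO11) + lam₂ * (TA11 - TO11)) := by
    have : lam₁ * (TA11 - TO11) + lam₂ * (TA11 - TO11) = (lam₁ + lam₂) * (TA11 - TO11) := by ring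
    rw [this, hsum, hκ₁, hκ₂]; ring
  rw [← sub_nonpos, hgoal]
  linarith [t00, t01, t10, t11a, t11b, piece₁, piece₂]

end BlockQ9

end

end Summit.CriticalPhenomena.PercolationContinuityZ3.Theorems
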